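import Literature.AlgebraicGeometry.HodgeTheory.PolarizedLimitMixedHodgeStructureHodgeNormEstimates
import Literature.Algebra.Lie.LefschetzModuleSL2RepresentationIntertwiners
import HarnessLib

/-!
# The limit Hodge norm on primitive vectors, explicitly: `|v|₀² = ‖v‖²_{F̂_♯} = (1/l!) · (i^a/i^b) · Q(v, N^l v̄)` for
# `v ∈ Î^{a,b} ∩ ker N^{l+1}`, `a + b = k + l`

Topic `Literature/AlgebraicGeometry/HodgeTheory` (namespaces `…HodgeTheory.LimitMixedHodgeStructure` and
`…HodgeTheory.PolarizedLimitMixedHodgeStructure`).  The Hodge norm estimates of this story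
(`PolarizedLimitMixedHodgeStructureHodgeNormEstimates`, `…HodgeNormLimit`, `…NilpotentOrbitLimits`) are stated with the
REFERENCE NORM `|·|₀ = ‖·‖_{F̂_♯}`, the Hodge norm of the polarized Hodge structure `F̂_♯ = exp(iN)·F̂` of the `ℝ`-split limit
mixed Hodge structure — exactly as printed: CKS (2.18) «`V = ⊕ U_ℓ` is orthogonal with respect to the Hodge form at `F̂₀`,
`S(C_{F̂₀}·, ·̄)`» and (3.7) «`‖v‖² = (-log|s|)^ℓ |v|₀²`».  This file COMPUTES `|·|₀` on the bigraded primitive pieces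
`P^{a,b} = I^{a,b} ∩ ker N^{l+1}` (`a + b = k + l`) in terms of the polarization data `(Q, N)` alone:
**`|v|₀² = (1/l!) · (i^a/i^b) · Q(v, N^l v̄)`**, the positive real of Def. 7.5.9 (4) (Schmid's polarization of the primitive part
`P_{k+l} ⊆ Gr^W_{k+l}` by `Q(·, N^l ·)`) divided by `l!`.  Theorems only; no definition, no instance, no named fact (D-0026 net debt `0`).

PRINTED SOURCES. E. Cattani, F. El Zein, P. Griffiths, Lê D. T., *Hodge Theory* (2014), §7.5: Def. 7.5.9 (4) «`Q(·, N^l ·̄)`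
polarizes the primitive part», (7.5.14) (the representation `ρ` of `SL₂` with `ρ_*(n₋) = N`), Thm. 7.5.13 (1) «`F_♯ = exp(iN)·F ∈ D`»
(the tree's `sharpPolarization`, whose positivity proof `pos_sharp` computes the Hodge form of `F_♯` string by string but exports
only `∃ r > 0`); E. Cattani, A. Kaplan, W. Schmid (LNM 1246, 1987) §2 (2.18), §3 (3.7); W. Schmid (1973) Thm. (6.6) (cite only).

THE PROOF (for `v ∈ P^{a,b}`, a highest weight vector of weight `l` of the `𝔰𝔩₂`-triple `(N⁺, H, N)`):
* §1 In `SL₂(ℂ)`: `(1 i; 0 1)(1 0; i/2 1)(1 -2i; 0 1) = (1 0; i 1)·diag(½, 2)`; applying the representation `ρ` (the tree's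
  `HasLefschetzProperty.sl2Rep`: upper unipotents `↦ exp(aN)`, lower `↦ exp(aN⁺)`, torus `↦ tʰ`) and evaluating at `v`
  (`N⁺v = 0`, `tʰ v = t^{-l} v`): **`c · exp(-2iN) v = 2^l v`** for the Cayley operator `c = exp(iN) exp((i/2)N⁺)`
  (`cayley_exp_neg_smul_N_apply_of_mem_primitiveSpace`).  Hence **`v = Σ_{t=0}^{l} c(u_t)`, `u_t = 2^{-l}(-2i)^t/t! · N^t v`**
  (`eq_sum_cayley_smul_pow_N_apply_of_mem_primitiveSpace`), and `c(u_t) ∈ c(E_{a-t}) = H_♯^{a-t,k-a+t}`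
  (`cayley_smul_pow_N_apply_mem_sharp_piece`): this IS the Hodge decomposition of `v` at `F_♯`.
* §2 The pieces are orthogonal for the Hodge form, so `‖v‖²_{F_♯} = Σ_t ‖c u_t‖²`; on `H_♯^{p,k-p}`, `‖x‖² = (i^p/i^{k-p}) Q(x, x̄)`
  and `Q(c x, conj(c y)) = Q(x, w_♯ ȳ)` (`Q_baseChange_cayley_conj_cayley`); the string formula for `w_♯` gives
  `(i^{a-t}/i^{k-a+t}) Q(N^t v, w_♯ conj(N^t v)) = (t!/(l-t)!) 2^{l-2t} · (i^a/i^b) Q(v, N^l v̄)`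
  (`hodgeSign_mul_Q_pow_sharpWeyl_conj_pow`, the explicit form of the tree's `pos_pow_sharpWeyl`); each term is therefore
  `2^{-l}/(t!(l-t)!) · (i^a/i^b) Q(v, N^l v̄)` (`hodgeSign_mul_Q_cayley_term`) and `Σ_t 2^{-l}/(t!(l-t)!) = 1/l!`:
  **`ofReal_hodgeNorm_sharp_sq_of_mem_deligneI_inf_ker`**, real form `hodgeNorm_sharp_sq_of_mem_deligneI_inf_ker`, and `l = 0`:
  `‖v‖²_{F_♯} = (i^a/i^b) Q(v, v̄)` on `I^{a,b} ∩ ker N`, `a + b = k`.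
* §3 For the `δ`-splitting of an arbitrary polarized limit mixed Hodge structure: **`|v|₀² = (1/l!) (i^a/i^b) Q(v, N^l v̄)`** on
  `Î^{a,b} ∩ ker N^{l+1}` (`ofReal_referenceNorm_sq_of_mem_deligneI_inf_ker`, `referenceNorm_sq_of_mem_deligneI_inf_ker`,
  `ofReal_referenceNorm_sq_of_mem_deligneI_inf_ker_N`).
* §4 by POLARIZATION (a sesquilinear form on a complex subspace is determined by its quadratic form; `x = v + w`, `x = v + iw`):
  **`Q(C_♯ v, w̄) = (1/l!) (i^a/i^b) Q(v, N^l w̄)` for `v, w ∈ P^{a,b}`** (`form_weilOperator_sharp_conj_of_mem_deligneI_inf_ker`) — the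
  Hodge FORM of `F_♯` («the Hodge form at `F̂₀`, `S(C_{F̂₀}·, ·̄)`», CKS (2.18)) on `P^{a,b}` is `1/l!` times the polarization form.
* §5 **distinct primitive pieces of the same weight are orthogonal**: `Q(C_♯ v, w̄) = 0` for `v ∈ P^{a,b}`, `w ∈ P^{a',b'}`,
  `a + b = a' + b' = k + l`, `a ≠ a'` (`form_weilOperator_sharp_conj_eq_zero_of_mem_deligneI_inf_ker_of_ne`; terms of the two Hodge
  decompositions in different `H_♯^{p}` are orthogonal, those in the same `H_♯^{p}` are cross terms of different string positions,
  `Q_baseChange_pow_sharpWeyl_conj_pow_eq_zero`, Balnojan–Hertling (3.10)).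
* §6 the same two statements for the reference form `⟨·,·⟩₀` of the `δ`-splitting (`Q_weilOperator_deltaSplit_sharp_conj_of_mem_deligneI_inf_ker`,
  `Q_weilOperator_deltaSplit_sharp_conj_eq_zero_of_ne`).

NOT HERE: the non-primitive vectors `N^j P^{a,b}` (same method, value `(j!… )`-weighted; not needed by the norm estimates, which
are stated on `Ê_m`), several variables.

## References

* [CattaniElZeinGriffithsLe2014] E. Cattani, F. El Zein, P. Griffiths, Lê D. T. (eds.), *Hodge Theory*, Math. Notes 49, Princeton
  (2014): §7.5 Def. 7.5.9 (4), (7.5.14), Thm. 7.5.13 (1); App. A (A.3.5).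
* [CattaniKaplanSchmid1987] E. Cattani, A. Kaplan, W. Schmid, *Variations of polarized Hodge structure: asymptotics and monodromy*,
  LNM 1246 (1987) 16–31: §2 (2.18), §3 Cor. (3.7) (p. 21).
* [CattaniKaplanSchmid1986] E. Cattani, A. Kaplan, W. Schmid, *Degeneration of Hodge structures*, Ann. of Math. 123 (1986): Lemma
  (3.12) (cite only).
* [Schmid1973] W. Schmid, Invent. Math. 22 (1973): Thm. (6.6), Cor. (6.7') (cite only).
* [CarlsonMullerStachPeters2017] J. Carlson, S. Müller-Stach, C. Peters, *Period Mappings and Period Domains*, 2nd ed. (2017): §2.3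
  Thm. 2.3.3, eq. (2.6).
* [BalnojanHertling2018] S. Balnojan, C. Hertling, Bull. Braz. Math. Soc. 50 (2019): Def. 3.3 (c)(iv)(β), Lemma 3.5 (3.10).
-/

noncomputable section

open scoped TensorProduct ComplexOrder Nat MatrixGroups

namespace Literature.AlgebraicGeometry.HodgeTheory

open Module Motives Motives.MixedHodgeStructure
open Motives.HodgeStructure (conj conj_conj conj_smul complexConj mem_complexConj conj_baseChange endConj endConj_apply
  conj_apply_eq_endConj hodgeSign weilOperator_apply_of_mem)
open Literature.Algebra.Lie (degreeSpace IsZGrading HasLefschetzProperty exp_smul_apply_eq_sum)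
open Literature.Algebra.Lie.HasLefschetzProperty (primitiveSpace mem_primitiveSpace_iff)

universe u

/-! ## §0 Tools -/

section Tools

/-- The finite exponential does not depend on the `ℚ`-module structure used to write it (the one through `ℚ → ℂ` of the
Lie-algebra files agrees with the canonical one). [folklore] -/
private theorem exp_compHom_eq {K M : Type*} [Field K] [CharZero K] [AddCommGroup M] [Module K M]
    [Module ℚ (Module.End K M)] (T : Module.End K M) :
    @IsNilpotent.exp (Module.End K M) _
        (@Algebra.toModule ℚ (Module.End K M) _ _ (Algebra.compHom (Module.End K M) (algebraMap ℚ K))) T =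
      IsNilpotent.exp T := by
  congr 1
  exact Subsingleton.elim _ _

/-- The `SL₂` identity behind `c⁻¹` on highest weight vectors: `(1 i; 0 1)(1 0; i/2 1)(1 -2i; 0 1) = (1 0; i 1)(½ 0; 0 2)`. [folklore] -/
private theorem sl2_gauss_identity :
    (!![(1 : ℂ), Complex.I; 0, 1] * !![1, 0; Complex.I / 2, 1] * !![1, -(2 * Complex.I); 0, 1] : Matrix (Fin 2) (Fin 2) ℂ) =
      !![1, 0; Complex.I, 1] * !![(2 : ℂ)⁻¹, 0; 0, (2 : ℂ)⁻¹⁻¹] := by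
  simp only [Matrix.mul_fin_two]
  ext i j; fin_cases i <;> fin_cases j
  · simp; linear_combination (1 / 2 : ℂ) * Complex.I_sq
  · simp; linear_combination (-Complex.I : ℂ) * Complex.I_sq
  · simp; ring
  · simp; linear_combination (-1 : ℂ) * Complex.I_sq

/-- `conj (2^{-l} (-2i)^t / t!) = 2^{-l} (2i)^t / t!`. [folklore] -/
private theorem conj_coeff (l t : ℕ) :
    starRingEnd ℂ ((2 : ℂ)⁻¹ ^ l * ((-(2 * Complex.I)) ^ t * ((t ! : ℕ) : ℂ)⁻¹)) =
      (2 : ℂ)⁻¹ ^ l * ((2 * Complex.I) ^ t * ((t ! : ℕ) : ℂ)⁻¹) := by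
  simp [map_mul, map_pow, map_inv₀, Complex.conj_I, map_neg, map_ofNat]

/-- The coefficient bookkeeping: `|2^{-l}(-2i)^t/t!|² · (t!/(l-t)!) 2^{l-t} 2^{-t} = 2^{-l} / (t! (l-t)!)`. [folklore] -/
private theorem coeff_identity {l t : ℕ} (ht : t ≤ l) :
    (2 : ℂ)⁻¹ ^ l * ((-(2 * Complex.I)) ^ t * ((t ! : ℕ) : ℂ)⁻¹) *
          ((2 : ℂ)⁻¹ ^ l * ((2 * Complex.I) ^ t * ((t ! : ℕ) : ℂ)⁻¹)) *
        (((t ! : ℕ) : ℂ) * (((l - t) ! : ℕ) : ℂ)⁻¹ * 2 ^ (l - t) * 2⁻¹ ^ t) =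
      (2 : ℂ)⁻¹ ^ l * (((t ! * (l - t) ! : ℕ) : ℕ) : ℂ)⁻¹ := by
  have h4 : (-(2 * Complex.I)) * (2 * Complex.I) = 2 * 2 := by linear_combination (-4 : ℂ) * Complex.I_sq
  have hpow : (-(2 * Complex.I)) ^ t * (2 * Complex.I) ^ t = (2 : ℂ) ^ t * 2 ^ t := by rw [← mul_pow, h4, mul_pow]
  have h2lt : (2 : ℂ) ^ (l - t) = 2 ^ l * (2 ^ t)⁻¹ := pow_sub₀ _ two_ne_zero ht
  have ht0 : ((t ! : ℕ) : ℂ) ≠ 0 := by exact_mod_cast (Nat.factorial_pos t).ne'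
  have hlt0 : (((l - t) ! : ℕ) : ℂ) ≠ 0 := by exact_mod_cast (Nat.factorial_pos _).ne'
  have h2t : (2 : ℂ) ^ t ≠ 0 := pow_ne_zero _ two_ne_zero
  have h2l : (2 : ℂ) ^ l ≠ 0 := pow_ne_zero _ two_ne_zero
  rw [Nat.cast_mul, h2lt, inv_pow]
  calc (2 ^ l : ℂ)⁻¹ * ((-(2 * Complex.I)) ^ t * ((t ! : ℕ) : ℂ)⁻¹) * ((2 ^ l)⁻¹ * ((2 * Complex.I) ^ t * ((t ! : ℕ) : ℂ)⁻¹)) *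
          (((t ! : ℕ) : ℂ) * (((l - t) ! : ℕ) : ℂ)⁻¹ * (2 ^ l * (2 ^ t)⁻¹) * 2⁻¹ ^ t)
      = ((-(2 * Complex.I)) ^ t * (2 * Complex.I) ^ t) *
          ((2 ^ l : ℂ)⁻¹ * (2 ^ l)⁻¹ * 2 ^ l * (2 ^ t)⁻¹ * 2⁻¹ ^ t) *
            (((t ! : ℕ) : ℂ)⁻¹ * (((t ! : ℕ) : ℂ)⁻¹ * ((t ! : ℕ) : ℂ)) * (((l - t) ! : ℕ) : ℂ)⁻¹) := by ring
    _ = (2 ^ l : ℂ)⁻¹ * (((t ! : ℕ) : ℂ) * (((l - t) ! : ℕ) : ℂ))⁻¹ := by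
        rw [hpow, inv_mul_cancel₀ ht0, mul_one, mul_inv, inv_pow]
        field_simp

/-- `Σ_{t=0}^{l} 1/(t! (l-t)!) = 2^l / l!` (the binomial theorem at `1 + 1`). [folklore] -/
private theorem sum_inv_factorial_mul_factorial (l : ℕ) :
    ∑ t ∈ Finset.range (l + 1), (((t ! * (l - t) ! : ℕ) : ℕ) : ℂ)⁻¹ = 2 ^ l * ((l ! : ℕ) : ℂ)⁻¹ := by
  have hl : ((l ! : ℕ) : ℂ) ≠ 0 := by exact_mod_cast (Nat.factorial_pos _).ne'
  have h : ∀ t ∈ Finset.range (l + 1), (((t ! * (l - t) ! : ℕ) : ℕ) : ℂ)⁻¹ = (l.choose t : ℂ) * ((l ! : ℕ) : ℂ)⁻¹ := by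
    intro t ht
    have htl : t ≤ l := Finset.mem_range_succ_iff.1 ht
    have hc : ((l.choose t : ℕ) : ℂ) * (((t ! * (l - t) ! : ℕ) : ℕ) : ℂ) = ((l ! : ℕ) : ℂ) := by
      rw [← Nat.choose_mul_factorial_mul_factorial htl]
      push_cast
      ring
    have hne : (((t ! * (l - t) ! : ℕ) : ℕ) : ℂ) ≠ 0 := by
      exact_mod_cast (Nat.mul_pos (Nat.factorial_pos _) (Nat.factorial_pos _)).ne'
    rw [eq_mul_inv_iff_mul_eq₀ hl, ← hc, mul_comm, mul_assoc, mul_inv_cancel₀ hne, mul_one]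
  rw [Finset.sum_congr rfl h, ← Finset.sum_mul]
  congr 1
  exact_mod_cast Nat.sum_range_choose l

/-- The scalar bookkeeping of the string formula: `(-1)^{m+2j} (2i)^{-j} (2i)^m (-1)^j = 2^m 2^{-j} i^{j} i^{-m}`. [folklore] -/
private theorem phase_core (m j : ℕ) :
    (-1 : ℂ) ^ (m + j + j) * ((2 * Complex.I)⁻¹ ^ j * (2 * Complex.I) ^ m) * (-1) ^ j =
      2 ^ m * 2⁻¹ ^ j * (Complex.I ^ j * (Complex.I ^ m)⁻¹) := by
  have h : (Complex.I ^ 4) ^ (2 * j) = 1 := by rw [Complex.I_pow_four, one_pow]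
  rw [mul_inv, ← inv_pow, Complex.inv_I, show (-1 : ℂ) = Complex.I ^ 2 from Complex.I_sq.symm,
    show -Complex.I = Complex.I ^ 3 by rw [pow_succ, Complex.I_sq]; ring]
  linear_combination (2 ^ m * (2⁻¹) ^ j * Complex.I ^ (3 * m + j)) * h

/-- **The phases cancel**: `i^{p} i^{-(k-p)} · [(-1)^{m+2j} (j!/m!) (2i)^{-j}(2i)^m] · (-1)^j = (j!/m!) 2^m 2^{-j} · i^{p+j} i^{-(k+m-p)}`.
[cite: CattaniElZeinGriffithsLe2014, §7.5 Thm. 7.5.13 (1)] -/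
private theorem phase_identity (p k : ℤ) (m j : ℕ) :
    Complex.I ^ p * (Complex.I ^ (k - p))⁻¹ *
        ((-1 : ℂ) ^ (m + j + j) * ((j ! : ℕ) : ℂ) * ((m ! : ℕ) : ℂ)⁻¹ * ((2 * Complex.I)⁻¹ ^ j * (2 * Complex.I) ^ m) *
          (-1) ^ j) =
      (((j ! : ℕ) : ℂ) * ((m ! : ℕ) : ℂ)⁻¹ * 2 ^ m * 2⁻¹ ^ j) *
        (Complex.I ^ (p + j) * (Complex.I ^ (k + m - p))⁻¹) := by
  have hI : Complex.I ≠ 0 := Complex.I_ne_zero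
  have e1 : (-1 : ℂ) ^ (m + j + j) * ((j ! : ℕ) : ℂ) * ((m ! : ℕ) : ℂ)⁻¹ * ((2 * Complex.I)⁻¹ ^ j * (2 * Complex.I) ^ m) *
      (-1) ^ j = ((j ! : ℕ) : ℂ) * ((m ! : ℕ) : ℂ)⁻¹ *
        ((-1 : ℂ) ^ (m + j + j) * ((2 * Complex.I)⁻¹ ^ j * (2 * Complex.I) ^ m) * (-1) ^ j) := by ring
  rw [e1, phase_core, zpow_add₀ hI, zpow_sub₀ hI, zpow_sub₀ hI, zpow_add₀ hI, zpow_natCast, zpow_natCast]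
  have hp : Complex.I ^ p ≠ 0 := zpow_ne_zero p hI
  have hk : Complex.I ^ k ≠ 0 := zpow_ne_zero k hI
  have hm : Complex.I ^ m ≠ 0 := pow_ne_zero m hI
  have hj : Complex.I ^ j ≠ 0 := pow_ne_zero j hI
  field_simp

end Tools

variable {V : Type u} [AddCommGroup V] [Module ℚ V] [FiniteDimensional ℚ V] {k : ℤ}

omit [FiniteDimensional ℚ V] in
/-- `exp(A) v = v` when `A v = 0` (`A` nilpotent). [folklore] -/
private theorem exp_apply_eq_self_of_apply_eq_zero {A : Module.End ℂ (ℂ ⊗[ℚ] V)} (hA : IsNilpotent A)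
    {v : ℂ ⊗[ℚ] V} (hv : A v = 0) : IsNilpotent.exp A v = v := by
  obtain ⟨n, hn⟩ := hA
  have hn' : A ^ (n + 1) = 0 := by rw [pow_succ, hn, zero_mul]
  have hpow : ∀ i : ℕ, (A ^ (i + 1)) v = 0 := fun i => by rw [pow_succ, Module.End.mul_apply, hv, map_zero]
  rw [IsNilpotent.exp_eq_sum hn', LinearMap.sum_apply, Finset.sum_range_succ']
  simp only [LinearMap.smul_apply, hpow, smul_zero, Finset.sum_const_zero, zero_add, pow_zero, Module.End.one_apply,
    Nat.factorial_zero, Nat.cast_one, inv_one, one_smul]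

/-! ## §1 `c (exp(-2iN) v) = 2^l v` for a primitive `v` of weight `l`, and the Hodge decomposition of `v` at `F_♯` -/

namespace LimitMixedHodgeStructure

variable (L : LimitMixedHodgeStructure V k)

/-- **`c · exp(-2iN_ℂ) · v = 2^l v` for `v ∈ P_{-l}` primitive** (`c = exp(iN_ℂ) exp((i/2)N⁺)` the Cayley operator): in `SL₂`,
`(1 i; 0 1)(1 0; i/2 1)(1 -2i; 0 1) = (1 0; i 1)·diag(½, 2)`, and on a highest weight vector `v` of weight `l` (`N⁺ v = 0`,
`H v = l v`) the right side acts by `2^l`. [cite: CattaniElZeinGriffithsLe2014, §7.5 Thm. 7.5.13 (1) and (7.5.14)]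
[cite: CattaniKaplanSchmid1986, Lemma (3.12) (cite only)] -/
theorem cayley_exp_neg_smul_N_apply_of_mem_primitiveSpace {l : ℕ} {v : ℂ ⊗[ℚ] V}
    (hv : v ∈ primitiveSpace (-L.deligneH) (L.N.baseChange ℂ) l) :
    L.cayley (IsNilpotent.exp ((-(2 * Complex.I)) • L.N.baseChange ℂ) v) = (2 : ℂ) ^ l • v := by
  have hd1 : Matrix.det !![(1 : ℂ), Complex.I; 0, 1] = 1 := by rw [Matrix.det_fin_two_of]; ring
  have hd2 : Matrix.det !![(1 : ℂ), 0; Complex.I / 2, 1] = 1 := by rw [Matrix.det_fin_two_of]; ring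
  have hd3 : Matrix.det !![(1 : ℂ), -(2 * Complex.I); 0, 1] = 1 := by rw [Matrix.det_fin_two_of]; ring
  have hd4 : Matrix.det !![(1 : ℂ), 0; Complex.I, 1] = 1 := by rw [Matrix.det_fin_two_of]; ring
  have hd5 : Matrix.det !![(2 : ℂ)⁻¹, 0; 0, (2 : ℂ)⁻¹⁻¹] = 1 := by rw [Matrix.det_fin_two_of, inv_inv]; norm_num
  let γ₁ : SL(2, ℂ) := ⟨_, hd1⟩
  let γ₂ : SL(2, ℂ) := ⟨_, hd2⟩
  let γ₃ : SL(2, ℂ) := ⟨_, hd3⟩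
  let γ₄ : SL(2, ℂ) := ⟨_, hd4⟩
  let γ₅ : SL(2, ℂ) := ⟨_, hd5⟩
  have hmat : γ₁ * γ₂ * γ₃ = γ₄ * γ₅ :=
    Subtype.ext (by simp only [Matrix.SpecialLinearGroup.coe_mul, γ₁, γ₂, γ₃, γ₄, γ₅]; exact sl2_gauss_identity)
  have hρ := congr_arg (L.hasLefschetzProperty_N.sl2Rep L.isZGrading_neg_deligneH) hmat
  rw [map_mul, map_mul, map_mul,
    L.hasLefschetzProperty_N.sl2Rep_apply_of_coe_eq_upper L.isZGrading_neg_deligneH γ₁ rfl,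
    L.hasLefschetzProperty_N.sl2Rep_apply_of_coe_eq_lower L.isZGrading_neg_deligneH γ₂ rfl,
    L.hasLefschetzProperty_N.sl2Rep_apply_of_coe_eq_upper L.isZGrading_neg_deligneH γ₃ rfl,
    L.hasLefschetzProperty_N.sl2Rep_apply_of_coe_eq_lower L.isZGrading_neg_deligneH γ₄ rfl,
    L.hasLefschetzProperty_N.sl2Rep_apply_of_coe_eq_diagonal L.isZGrading_neg_deligneH γ₅ rfl,
    exp_compHom_eq, exp_compHom_eq, exp_compHom_eq, exp_compHom_eq] at hρ
  have h := LinearMap.congr_fun hρ v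
  have hR : IsNilpotent.exp (Complex.I • L.hasLefschetzProperty_N.dual L.isZGrading_neg_deligneH) ((2 : ℂ) ^ l • v) =
      (2 : ℂ) ^ l • v :=
    exp_apply_eq_self_of_apply_eq_zero ((L.hasLefschetzProperty_N.isNilpotent_dual L.isZGrading_neg_deligneH).smul _)
      (by rw [LinearMap.smul_apply, map_smul, L.hasLefschetzProperty_N.dual_apply_primitive L.isZGrading_neg_deligneH hv,
        smul_zero, smul_zero])
  rw [Module.End.mul_apply, Module.End.mul_apply, Module.End.mul_apply,
    L.isZGrading_neg_deligneH.torus_apply_of_mem _ (mem_primitiveSpace_iff.1 hv).1, zpow_neg, inv_zpow, inv_inv,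
    zpow_natCast, hR] at h
  rw [cayley, Module.End.mul_apply]
  exact h

omit [FiniteDimensional ℚ V] in
/-- `exp(aN_ℂ) v = Σ_{t ≤ l} (a^t/t!) N^t v` when `N^{l+1} v = 0` (the finite exponential series on a vector). [folklore] -/
private theorem exp_smul_N_apply_eq_sum_of_pow_apply_eq_zero (a : ℂ) {l : ℕ} {v : ℂ ⊗[ℚ] V}
    (hv : (L.N.baseChange ℂ ^ (l + 1)) v = 0) :
    IsNilpotent.exp (a • L.N.baseChange ℂ) v =
      ∑ t ∈ Finset.range (l + 1), (a ^ t * ((t ! : ℕ) : ℂ)⁻¹) • (L.N.baseChange ℂ ^ t) v := by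
  obtain ⟨n, hn⟩ := L.isNilpotent_N_baseChange
  have hN : L.N.baseChange ℂ ^ (l + 1 + n) = 0 := by rw [pow_add, hn, mul_zero]
  have h := exp_smul_apply_eq_sum hN a v
  rw [exp_compHom_eq] at h
  rw [h]
  symm
  refine Finset.sum_subset (Finset.range_mono (Nat.le_add_right _ _)) fun t ht ht' => ?_
  have hlt : l + 1 ≤ t := by
    rw [Finset.mem_range, not_lt] at ht'
    exact ht'
  rw [show L.N.baseChange ℂ ^ t = L.N.baseChange ℂ ^ (t - (l + 1)) * L.N.baseChange ℂ ^ (l + 1) by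
    rw [← pow_add, Nat.sub_add_cancel hlt], Module.End.mul_apply, hv, map_zero, smul_zero]

/-- **The Hodge decomposition of a primitive vector at `F_♯`, explicitly**:
`v = Σ_{t=0}^{l} c( 2^{-l} (-2i)^t / t! · N^t v )` for `v ∈ P_{-l}` — the `t`-th term lies in `c(E_{a-t}) = H_♯^{a-t, k-a+t}` when
`v ∈ I^{a,b}`. [cite: CattaniElZeinGriffithsLe2014, §7.5 Thm. 7.5.13 (1)] [cite: CattaniKaplanSchmid1986, Lemma (3.12) (cite only)] -/
theorem eq_sum_cayley_smul_pow_N_apply_of_mem_primitiveSpace {l : ℕ} {v : ℂ ⊗[ℚ] V}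
    (hv : v ∈ primitiveSpace (-L.deligneH) (L.N.baseChange ℂ) l) :
    v = ∑ t ∈ Finset.range (l + 1),
      L.cayley (((2 : ℂ)⁻¹ ^ l * ((-(2 * Complex.I)) ^ t * ((t ! : ℕ) : ℂ)⁻¹)) • (L.N.baseChange ℂ ^ t) v) := by
  have h1 := L.cayley_exp_neg_smul_N_apply_of_mem_primitiveSpace hv
  have h2 := L.exp_smul_N_apply_eq_sum_of_pow_apply_eq_zero (-(2 * Complex.I)) (mem_primitiveSpace_iff.1 hv).2
  have h2l : (2 : ℂ) ^ l ≠ 0 := pow_ne_zero _ two_ne_zero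
  calc v = (2 : ℂ)⁻¹ ^ l • L.cayley (IsNilpotent.exp ((-(2 * Complex.I)) • L.N.baseChange ℂ) v) := by
        rw [h1, smul_smul, inv_pow, inv_mul_cancel₀ h2l, one_smul]
    _ = _ := by
        rw [← map_smul, h2, Finset.smul_sum, map_sum]
        refine Finset.sum_congr rfl fun t _ => ?_
        rw [smul_smul]

/-- **The terms lie in distinct Hodge pieces of `F_♯`**: `c(β N^t v) ∈ H_♯^{a-t, k-a+t}` for `v ∈ I^{a,b}` (`N^t v ∈ I^{a-t,b-t} ⊆ E_{a-t}`
and `H_♯^{p,k-p} = c(E_p)`). [cite: CattaniElZeinGriffithsLe2014, §7.5 Thm. 7.5.13 (1)] -/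
theorem cayley_smul_pow_N_apply_mem_sharp_piece (hsplit : L.toMixedHodgeStructure.IsSplitOverR) {a b : ℤ} (t : ℕ) (c : ℂ)
    {v : ℂ ⊗[ℚ] V} (hv : v ∈ L.toMixedHodgeStructure.deligneI a b) :
    L.cayley (c • (L.N.baseChange ℂ ^ t) v) ∈ (L.sharp hsplit).piece (a - t) (k - (a - t)) := by
  rw [L.sharp_piece_eq_map hsplit (show a - t + (k - (a - t)) = k by ring)]
  refine ⟨c • (L.N.baseChange ℂ ^ t) v, Submodule.smul_mem _ c ?_, rfl⟩
  have hNt : (L.N.baseChange ℂ ^ t) v ∈ L.toMixedHodgeStructure.deligneI (a - t) (b - t) := by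
    rw [← LinearMap.baseChange_pow]
    exact L.map_pow_N_deligneI_le t a b ⟨v, hv, rfl⟩
  exact Submodule.mem_iSup_of_mem (a - (t : ℤ), b - (t : ℤ)) (Submodule.mem_iSup_of_mem rfl hNt)

end LimitMixedHodgeStructure

/-! ## §2 The Hodge norm of `F_♯` on a bigraded primitive vector: `‖v‖²_{F_♯} = (1/l!) · i^{a-b} Q(v, N^l v̄)` -/

namespace PolarizedLimitMixedHodgeStructure

variable (L : PolarizedLimitMixedHodgeStructure V k)

/-- On a Hodge piece of `F_♯` the Hodge norm squared is the twisted form: `‖x‖²_{F_♯} = (i^p/i^{k-p}) Q(x, x̄)` for `x ∈ H_♯^{p,k-p}`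
(as a complex number). [cite: CarlsonMullerStachPeters2017, §2.3 Thm. 2.3.3 and eq. (2.6)] [cite: CattaniElZeinGriffithsLe2014, §7.5 Thm. 7.5.13 (1)] -/
theorem ofReal_hodgeNorm_sharp_sq_of_mem_piece (hsplit : L.toMixedHodgeStructure.IsSplitOverR) {p : ℤ} {x : ℂ ⊗[ℚ] V}
    (hx : x ∈ (L.toLimitMixedHodgeStructure.sharp hsplit).piece p (k - p)) :
    (((L.sharpPolarization hsplit).hodgeNorm x ^ 2 : ℝ) : ℂ) = hodgeSign k p * L.Q.baseChange ℂ x (conj x) := by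
  rw [← (L.sharpPolarization hsplit).form_weilOperator_conj_self_eq_hodgeNorm_sq x, weilOperator_apply_of_mem _ hx,
    LinearMap.map_smul₂, smul_eq_mul, sharpPolarization_form]

/-- **The string formula, explicitly** (the value hidden in `pos_pow_sharpWeyl`): for `v ∈ P^{p+j, k+m-p}` and `x = N^j v`,
`(i^p/i^{k-p}) · Q(x, w_♯ x̄) = (j!/m!) 2^{m-j} · (i^{p+j}/i^{k+m-p}) · Q(v, N^{m+j} v̄)` (`w_♯` the rescaled Weyl operator,
`Q(c x, conj(c y)) = Q(x, w_♯ ȳ)`). [cite: CattaniElZeinGriffithsLe2014, §7.5 Thm. 7.5.13 (1) with (A.3.5)] [cite: BalnojanHertling2018, Def. 3.3 (c)(iv)(β)] -/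
theorem hodgeSign_mul_Q_pow_sharpWeyl_conj_pow (hsplit : L.toMixedHodgeStructure.IsSplitOverR) {p : ℤ} {m j : ℕ}
    {v : ℂ ⊗[ℚ] V}
    (hv : v ∈ L.toMixedHodgeStructure.deligneI (p + j) (k + m - p) ⊓ LinearMap.ker (L.N.baseChange ℂ ^ (m + j + 1))) :
    Complex.I ^ p * (Complex.I ^ (k - p))⁻¹ *
        L.Q.baseChange ℂ ((L.N.baseChange ℂ ^ j) v) (L.sharpWeyl (conj ((L.N.baseChange ℂ ^ j) v))) =
      (((j ! : ℕ) : ℂ) * ((m ! : ℕ) : ℂ)⁻¹ * 2 ^ m * 2⁻¹ ^ j) *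
        (Complex.I ^ (p + j) * (Complex.I ^ (k + m - p))⁻¹ * L.Q.baseChange ℂ v ((L.N.baseChange ℂ ^ (m + j)) (conj v))) := by
  have hNN : (L.N ^ j).baseChange ℂ ((L.N ^ m).baseChange ℂ (conj v)) = (L.N.baseChange ℂ ^ (m + j)) (conj v) := by
    rw [← LinearMap.comp_apply, ← LinearMap.baseChange_comp, ← Module.End.mul_eq_comp, ← pow_add, add_comm,
      LinearMap.baseChange_pow]
  rw [L.sharpWeyl_conj_pow_apply hsplit hv, map_smul, smul_eq_mul, ← LinearMap.baseChange_pow, ← LinearMap.baseChange_pow,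
    L.Q_baseChange_pow_N j, hNN]
  set Qv := L.Q.baseChange ℂ v ((L.N.baseChange ℂ ^ (m + j)) (conj v)) with hQv
  set κ := (-1 : ℂ) ^ (m + j + j) * ((j ! : ℕ) : ℂ) * ((m ! : ℕ) : ℂ)⁻¹ * ((2 * Complex.I)⁻¹ ^ j * (2 * Complex.I) ^ m)
    with hκ
  calc Complex.I ^ p * (Complex.I ^ (k - p))⁻¹ * (κ * ((-1) ^ j * Qv))
      = Complex.I ^ p * (Complex.I ^ (k - p))⁻¹ * (κ * (-1) ^ j) * Qv := by ring
    _ = (((j ! : ℕ) : ℂ) * ((m ! : ℕ) : ℂ)⁻¹ * 2 ^ m * 2⁻¹ ^ j) *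
          (Complex.I ^ (p + j) * (Complex.I ^ (k + m - p))⁻¹) * Qv := by rw [hκ, phase_identity]
    _ = _ := by ring

/-- **One term of the Hodge decomposition**: for `v ∈ I^{a,b} ∩ ker N^{l+1}` (`a + b = k + l`), `t ≤ l`, and
`u_t = 2^{-l}(-2i)^t/t! · N^t v`: `(i^{a-t}/i^{k-a+t}) Q(c u_t, conj(c u_t)) = 2^{-l}/(t!(l-t)!) · (i^a/i^b) Q(v, N^l v̄)`.
[cite: CattaniElZeinGriffithsLe2014, §7.5 Thm. 7.5.13 (1)] [cite: CattaniKaplanSchmid1986, Lemma (3.12) (cite only)] -/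
theorem hodgeSign_mul_Q_cayley_term (hsplit : L.toMixedHodgeStructure.IsSplitOverR) {l t : ℕ} (ht : t ≤ l) {a b : ℤ}
    (hab : a + b = k + l) {v : ℂ ⊗[ℚ] V}
    (hv : v ∈ L.toMixedHodgeStructure.deligneI a b ⊓ LinearMap.ker (L.N.baseChange ℂ ^ (l + 1))) :
    hodgeSign k (a - t) *
        L.Q.baseChange ℂ (L.cayley (((2 : ℂ)⁻¹ ^ l * ((-(2 * Complex.I)) ^ t * ((t ! : ℕ) : ℂ)⁻¹)) • (L.N.baseChange ℂ ^ t) v))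
          (conj (L.cayley (((2 : ℂ)⁻¹ ^ l * ((-(2 * Complex.I)) ^ t * ((t ! : ℕ) : ℂ)⁻¹)) • (L.N.baseChange ℂ ^ t) v))) =
      ((2 : ℂ)⁻¹ ^ l * (((t ! * (l - t) ! : ℕ) : ℕ) : ℂ)⁻¹) *
        (Complex.I ^ a * (Complex.I ^ b)⁻¹ * L.Q.baseChange ℂ v ((L.N.baseChange ℂ ^ l) (conj v))) := by
  have e1 : a - (t : ℕ) + ((t : ℕ) : ℤ) = a := by ring
  have e2 : k + ((l - t : ℕ) : ℤ) - (a - (t : ℕ)) = b := by rw [Nat.cast_sub ht]; omega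
  have e3 : l - t + t + 1 = l + 1 := by rw [Nat.sub_add_cancel ht]
  have hv' : v ∈ L.toMixedHodgeStructure.deligneI (a - (t : ℕ) + ((t : ℕ) : ℤ)) (k + ((l - t : ℕ) : ℤ) - (a - (t : ℕ))) ⊓
      LinearMap.ker (L.N.baseChange ℂ ^ (l - t + t + 1)) := by
    rw [e1, e2, e3]
    exact hv
  have key := L.hodgeSign_mul_Q_pow_sharpWeyl_conj_pow hsplit hv'
  rw [e1, e2, Nat.sub_add_cancel ht] at key
  rw [L.Q_baseChange_cayley_conj_cayley hsplit, conj_smul, LinearMap.map_smul₂, map_smul, map_smul, smul_eq_mul, smul_eq_mul,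
    conj_coeff, hodgeSign]
  calc Complex.I ^ (a - (t : ℕ)) * (Complex.I ^ (k - (a - (t : ℕ))))⁻¹ *
        ((2 : ℂ)⁻¹ ^ l * ((-(2 * Complex.I)) ^ t * ((t ! : ℕ) : ℂ)⁻¹) *
          ((2 : ℂ)⁻¹ ^ l * ((2 * Complex.I) ^ t * ((t ! : ℕ) : ℂ)⁻¹) *
            L.Q.baseChange ℂ ((L.N.baseChange ℂ ^ t) v) (L.sharpWeyl (conj ((L.N.baseChange ℂ ^ t) v)))))
      = (2 : ℂ)⁻¹ ^ l * ((-(2 * Complex.I)) ^ t * ((t ! : ℕ) : ℂ)⁻¹) * ((2 : ℂ)⁻¹ ^ l * ((2 * Complex.I) ^ t * ((t ! : ℕ) : ℂ)⁻¹)) *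
          (Complex.I ^ (a - (t : ℕ)) * (Complex.I ^ (k - (a - (t : ℕ))))⁻¹ *
            L.Q.baseChange ℂ ((L.N.baseChange ℂ ^ t) v) (L.sharpWeyl (conj ((L.N.baseChange ℂ ^ t) v)))) := by ring
    _ = (2 : ℂ)⁻¹ ^ l * ((-(2 * Complex.I)) ^ t * ((t ! : ℕ) : ℂ)⁻¹) * ((2 : ℂ)⁻¹ ^ l * ((2 * Complex.I) ^ t * ((t ! : ℕ) : ℂ)⁻¹)) *
          ((((t ! : ℕ) : ℂ) * (((l - t) ! : ℕ) : ℂ)⁻¹ * 2 ^ (l - t) * 2⁻¹ ^ t) *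
            (Complex.I ^ a * (Complex.I ^ b)⁻¹ * L.Q.baseChange ℂ v ((L.N.baseChange ℂ ^ l) (conj v)))) := by rw [key]
    _ = (2 : ℂ)⁻¹ ^ l * ((-(2 * Complex.I)) ^ t * ((t ! : ℕ) : ℂ)⁻¹) * ((2 : ℂ)⁻¹ ^ l * ((2 * Complex.I) ^ t * ((t ! : ℕ) : ℂ)⁻¹)) *
          (((t ! : ℕ) : ℂ) * (((l - t) ! : ℕ) : ℂ)⁻¹ * 2 ^ (l - t) * 2⁻¹ ^ t) *
            (Complex.I ^ a * (Complex.I ^ b)⁻¹ * L.Q.baseChange ℂ v ((L.N.baseChange ℂ ^ l) (conj v))) := by ring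
    _ = _ := by rw [coeff_identity ht]

/-- **THE HODGE NORM OF `F_♯` ON A BIGRADED PRIMITIVE VECTOR: `‖v‖²_{F_♯} = (1/l!) · (i^a/i^b) · Q(v, N^l v̄)`** for
`v ∈ P^{a,b} = I^{a,b} ∩ ker N^{l+1}`, `a + b = k + l` (as a complex number; the right side is the positive real of Def. 7.5.9 (4) /
Balnojan–Hertling (iv)(β), divided by `l!`): `v = Σ_t c(u_t)` is its Hodge decomposition at `F_♯` (§1), the pieces are orthogonal,
and `Σ_{t=0}^{l} 2^{-l}/(t!(l-t)!) = 1/l!`. For the `ℝ`-split `(W, F)` this is the reference norm `|v|₀²` of the norm estimates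
(`|·|₀ = ‖·‖_{F̂_♯}`, CKS (2.18)/(3.7)), made explicit on primitive classes. [cite: CattaniElZeinGriffithsLe2014, §7.5 Thm. 7.5.13 (1) with Def. 7.5.9 (4)]
[cite: CattaniKaplanSchmid1987, §2 (2.18) and §3 Cor. (3.7)] [cite: Schmid1973, Thm. (6.6) (cite only)] -/
theorem ofReal_hodgeNorm_sharp_sq_of_mem_deligneI_inf_ker (hsplit : L.toMixedHodgeStructure.IsSplitOverR) {l : ℕ} {a b : ℤ}
    (hab : a + b = k + l) {v : ℂ ⊗[ℚ] V}
    (hv : v ∈ L.toMixedHodgeStructure.deligneI a b ⊓ LinearMap.ker (L.N.baseChange ℂ ^ (l + 1))) :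
    (((L.sharpPolarization hsplit).hodgeNorm v ^ 2 : ℝ) : ℂ) =
      ((l ! : ℕ) : ℂ)⁻¹ * (Complex.I ^ a * (Complex.I ^ b)⁻¹ * L.Q.baseChange ℂ v ((L.N.baseChange ℂ ^ l) (conj v))) := by
  have hprim : v ∈ primitiveSpace (-L.deligneH) (L.N.baseChange ℂ) l := L.deligneI_inf_ker_pow_le_primitiveSpace l hab hv
  set f : ℕ → ℂ ⊗[ℚ] V := fun t =>
    L.cayley (((2 : ℂ)⁻¹ ^ l * ((-(2 * Complex.I)) ^ t * ((t ! : ℕ) : ℂ)⁻¹)) • (L.N.baseChange ℂ ^ t) v) with hf_def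
  have hf : ∀ t : ℕ, f t ∈ (L.toLimitMixedHodgeStructure.sharp hsplit).piece (a - t) (k - (a - t)) := fun t =>
    L.cayley_smul_pow_N_apply_mem_sharp_piece hsplit t _ hv.1
  have hdec : ∑ t ∈ Finset.range (l + 1), f t = v :=
    (L.eq_sum_cayley_smul_pow_N_apply_of_mem_primitiveSpace hprim).symm
  have hpy := (L.sharpPolarization hsplit).hodgeNorm_sum_sq_of_pairwise (Finset.range (l + 1)) f (fun i _ j _ hij => by
    rw [weilOperator_apply_of_mem _ (hf j), LinearMap.map_smul₂,
      (L.sharpPolarization hsplit).form_piece_conj_piece (show a - (j : ℕ) ≠ a - (i : ℕ) by omega) (hf j) (hf i), smul_zero])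
  rw [hdec] at hpy
  rw [hpy, Complex.ofReal_sum, Finset.sum_congr rfl fun t ht =>
    (L.ofReal_hodgeNorm_sharp_sq_of_mem_piece hsplit (hf t)).trans
      (L.hodgeSign_mul_Q_cayley_term hsplit (Finset.mem_range_succ_iff.1 ht) hab hv),
    ← Finset.sum_mul, ← Finset.mul_sum, sum_inv_factorial_mul_factorial l, ← mul_assoc, inv_pow,
    inv_mul_cancel_left₀ (pow_ne_zero _ (two_ne_zero : (2 : ℂ) ≠ 0)), mul_assoc]

/-- The same as a real number: `‖v‖²_{F_♯} = Re((1/l!) (i^a/i^b) Q(v, N^l v̄))`. [cite: CattaniElZeinGriffithsLe2014, §7.5 Thm. 7.5.13 (1) with Def. 7.5.9 (4)]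
[cite: CattaniKaplanSchmid1987, §3 Cor. (3.7)] -/
theorem hodgeNorm_sharp_sq_of_mem_deligneI_inf_ker (hsplit : L.toMixedHodgeStructure.IsSplitOverR) {l : ℕ} {a b : ℤ}
    (hab : a + b = k + l) {v : ℂ ⊗[ℚ] V}
    (hv : v ∈ L.toMixedHodgeStructure.deligneI a b ⊓ LinearMap.ker (L.N.baseChange ℂ ^ (l + 1))) :
    (L.sharpPolarization hsplit).hodgeNorm v ^ 2 =
      (((l ! : ℕ) : ℂ)⁻¹ * (Complex.I ^ a * (Complex.I ^ b)⁻¹ * L.Q.baseChange ℂ v ((L.N.baseChange ℂ ^ l) (conj v)))).re := by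
  rw [← L.ofReal_hodgeNorm_sharp_sq_of_mem_deligneI_inf_ker hsplit hab hv, Complex.ofReal_re]

/-- **The weight-`k` invariant part: `‖v‖²_{F_♯} = (i^a/i^b) Q(v, v̄)` for `v ∈ I^{a,b} ∩ ker N`, `a + b = k`** — on `P^{a,b}` with
`l = 0` the Hodge norm of `F_♯` is the Hodge norm of the pure polarized Hodge structure `Gr^W_k` (primitive part).
[cite: CattaniElZeinGriffithsLe2014, §7.5 Thm. 7.5.13 (1) with Def. 7.5.9 (4)] [cite: Schmid1973, Thm. (6.6) (cite only)] -/
theorem ofReal_hodgeNorm_sharp_sq_of_mem_deligneI_inf_ker_N (hsplit : L.toMixedHodgeStructure.IsSplitOverR) {a b : ℤ}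
    (hab : a + b = k) {v : ℂ ⊗[ℚ] V}
    (hv : v ∈ L.toMixedHodgeStructure.deligneI a b ⊓ LinearMap.ker (L.N.baseChange ℂ)) :
    (((L.sharpPolarization hsplit).hodgeNorm v ^ 2 : ℝ) : ℂ) = Complex.I ^ a * (Complex.I ^ b)⁻¹ * L.Q.baseChange ℂ v (conj v) := by
  have hv' : v ∈ L.toMixedHodgeStructure.deligneI a b ⊓ LinearMap.ker (L.N.baseChange ℂ ^ (0 + 1)) := by
    rw [zero_add, pow_one]
    exact hv
  rw [L.ofReal_hodgeNorm_sharp_sq_of_mem_deligneI_inf_ker hsplit (l := 0) (by rw [hab]; simp) hv', Nat.factorial_zero,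
    Nat.cast_one, inv_one, one_mul, pow_zero, Module.End.one_apply]

/-! ## §3 The reference norm `|·|₀` of the norm estimates on primitive vectors of the `δ`-splitting -/

/-- **THE LIMIT HODGE NORM ON PRIMITIVE VECTORS, EXPLICITLY: `|v|₀² = (1/l!) · (i^a/i^b) · Q(v, N^l v̄)`** for
`v ∈ Î^{a,b} ∩ ker N^{l+1}`, `a + b = k + l`, where `Î` is Deligne's bigrading of the `δ`-split (`ℝ`-split) limit mixed Hodge
structure `(W, F̂)` and `|·|₀ = ‖·‖_{F̂_♯}` is the reference norm of the Hodge norm estimates «`‖v‖² = (-log|s|)^ℓ |v|₀²` for any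
locally flat section `v ∈ U_ℓ`» (`Î^{a,b} ⊆ Ê_{a+b} = U_l`, `l = a + b - k`): the limit Hodge metric on a primitive flat section is
`1/l!` times Schmid's polarization `(i^a/i^b) Q(·, N^l ·̄)` of the primitive part of `Gr^W_{k+l}`.
[cite: CattaniKaplanSchmid1987, §2 (2.18) and §3 Cor. (3.7) (p. 21)] [cite: Schmid1973, Thm. (6.6) (cite only)]
[cite: CattaniElZeinGriffithsLe2014, §7.5 Thm. 7.5.13 (1) with Def. 7.5.9 (4)] -/
theorem ofReal_referenceNorm_sq_of_mem_deligneI_inf_ker {l : ℕ} {a b : ℤ} (hab : a + b = k + l) {v : ℂ ⊗[ℚ] V}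
    (hv : v ∈ L.deltaSplit.toMixedHodgeStructure.deligneI a b ⊓ LinearMap.ker (L.N.baseChange ℂ ^ (l + 1))) :
    ((L.referenceNorm v ^ 2 : ℝ) : ℂ) =
      ((l ! : ℕ) : ℂ)⁻¹ * (Complex.I ^ a * (Complex.I ^ b)⁻¹ * L.Q.baseChange ℂ v ((L.N.baseChange ℂ ^ l) (conj v))) :=
  L.deltaSplit.ofReal_hodgeNorm_sharp_sq_of_mem_deligneI_inf_ker L.isSplitOverR_deltaSplit hab hv

/-- Real form: `|v|₀² = Re((1/l!) (i^a/i^b) Q(v, N^l v̄))` on `Î^{a,b} ∩ ker N^{l+1}`, `a + b = k + l`.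
[cite: CattaniKaplanSchmid1987, §3 Cor. (3.7) (p. 21)] [cite: Schmid1973, Thm. (6.6) (cite only)] -/
theorem referenceNorm_sq_of_mem_deligneI_inf_ker {l : ℕ} {a b : ℤ} (hab : a + b = k + l) {v : ℂ ⊗[ℚ] V}
    (hv : v ∈ L.deltaSplit.toMixedHodgeStructure.deligneI a b ⊓ LinearMap.ker (L.N.baseChange ℂ ^ (l + 1))) :
    L.referenceNorm v ^ 2 =
      (((l ! : ℕ) : ℂ)⁻¹ * (Complex.I ^ a * (Complex.I ^ b)⁻¹ * L.Q.baseChange ℂ v ((L.N.baseChange ℂ ^ l) (conj v)))).re := by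
  rw [← L.ofReal_referenceNorm_sq_of_mem_deligneI_inf_ker hab hv, Complex.ofReal_re]

/-- **`l = 0`: `|v|₀² = (i^a/i^b) Q(v, v̄)` for `v ∈ Î^{a,b} ∩ ker N`, `a + b = k`** — on `N`-invariant vectors of weight `k` the limit
Hodge norm is the Hodge norm of the polarized pure Hodge structure on the primitive part of `Gr^W_k`.
[cite: CattaniKaplanSchmid1987, §3 Cor. (3.7) (p. 21)] [cite: Schmid1973, Thm. (6.6) and Cor. (6.7') (cite only)] -/
theorem ofReal_referenceNorm_sq_of_mem_deligneI_inf_ker_N {a b : ℤ} (hab : a + b = k) {v : ℂ ⊗[ℚ] V}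
    (hv : v ∈ L.deltaSplit.toMixedHodgeStructure.deligneI a b ⊓ LinearMap.ker (L.N.baseChange ℂ)) :
    ((L.referenceNorm v ^ 2 : ℝ) : ℂ) = Complex.I ^ a * (Complex.I ^ b)⁻¹ * L.Q.baseChange ℂ v (conj v) :=
  L.deltaSplit.ofReal_hodgeNorm_sharp_sq_of_mem_deligneI_inf_ker_N L.isSplitOverR_deltaSplit hab hv

/-! ## §4 The Hodge FORM of `F_♯` on `P^{a,b}` by polarization -/

/-- **THE HODGE FORM OF `F_♯` ON A BIGRADED PRIMITIVE PIECE: `Q(C_♯ v, w̄) = (1/l!) · (i^a/i^b) · Q(v, N^l w̄)`** for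
`v, w ∈ P^{a,b} = I^{a,b} ∩ ker N^{l+1}`, `a + b = k + l` — the sesquilinear form `⟨·,·⟩_{F_♯} = Q(C_♯ ·, ·̄)` (CKS's «Hodge form at
`F̂₀`, `S(C_{F̂₀}·, ·̄)`») agrees on `P^{a,b}` with `1/l!` times the polarization form of Def. 7.5.9 (4): both are sesquilinear on the
complex subspace `P^{a,b}` and have the same quadratic form (`ofReal_hodgeNorm_sharp_sq_of_mem_deligneI_inf_ker`), so they agree
(polarization: `x = v + w` and `x = v + i w`). [cite: CattaniElZeinGriffithsLe2014, §7.5 Thm. 7.5.13 (1) with Def. 7.5.9 (4)]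
[cite: CattaniKaplanSchmid1987, §2 (2.18) and §3 Cor. (3.7)] -/
theorem form_weilOperator_sharp_conj_of_mem_deligneI_inf_ker (hsplit : L.toMixedHodgeStructure.IsSplitOverR) {l : ℕ} {a b : ℤ}
    (hab : a + b = k + l) {v w : ℂ ⊗[ℚ] V}
    (hv : v ∈ L.toMixedHodgeStructure.deligneI a b ⊓ LinearMap.ker (L.N.baseChange ℂ ^ (l + 1)))
    (hw : w ∈ L.toMixedHodgeStructure.deligneI a b ⊓ LinearMap.ker (L.N.baseChange ℂ ^ (l + 1))) :
    L.Q.baseChange ℂ ((L.toLimitMixedHodgeStructure.sharp hsplit).weilOperator v) (conj w) =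
      ((l ! : ℕ) : ℂ)⁻¹ * (Complex.I ^ a * (Complex.I ^ b)⁻¹ * L.Q.baseChange ℂ v ((L.N.baseChange ℂ ^ l) (conj w))) := by
  -- the quadratic forms agree on `P^{a,b}`
  have hdiag : ∀ x ∈ L.toMixedHodgeStructure.deligneI a b ⊓ LinearMap.ker (L.N.baseChange ℂ ^ (l + 1)),
      L.Q.baseChange ℂ ((L.toLimitMixedHodgeStructure.sharp hsplit).weilOperator x) (conj x) =
        ((l ! : ℕ) : ℂ)⁻¹ * (Complex.I ^ a * (Complex.I ^ b)⁻¹ * L.Q.baseChange ℂ x ((L.N.baseChange ℂ ^ l) (conj x))) :=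
    fun x hx => by
      rw [← L.ofReal_hodgeNorm_sharp_sq_of_mem_deligneI_inf_ker hsplit hab hx]
      exact (L.sharpPolarization hsplit).form_weilOperator_conj_self_eq_hodgeNorm_sq x
  have h1 := hdiag (v + w) (Submodule.add_mem _ hv hw)
  have h2 := hdiag (v + Complex.I • w) (Submodule.add_mem _ hv (Submodule.smul_mem _ _ hw))
  have h3 := hdiag v hv
  have h4 := hdiag w hw
  simp only [map_add, map_smul, conj_smul, LinearMap.add_apply, LinearMap.smul_apply, smul_eq_mul, Complex.conj_I] at h1 h2
  have hI : Complex.I * Complex.I = -1 := Complex.I_mul_I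
  linear_combination (1 / 2 : ℂ) * h1 + (Complex.I / 2) * h2 - ((1 + Complex.I) / 2) * h3 - ((1 + Complex.I) / 2) * h4 +
    ((L.Q.baseChange ℂ ((L.toLimitMixedHodgeStructure.sharp hsplit).weilOperator v) (conj w) -
          ((l ! : ℕ) : ℂ)⁻¹ * (Complex.I ^ a * (Complex.I ^ b)⁻¹ * L.Q.baseChange ℂ v ((L.N.baseChange ℂ ^ l) (conj w)))) / 2 -
        (L.Q.baseChange ℂ ((L.toLimitMixedHodgeStructure.sharp hsplit).weilOperator w) (conj v) -
          ((l ! : ℕ) : ℂ)⁻¹ * (Complex.I ^ a * (Complex.I ^ b)⁻¹ * L.Q.baseChange ℂ w ((L.N.baseChange ℂ ^ l) (conj v)))) / 2 +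
      Complex.I / 2 *
        (L.Q.baseChange ℂ ((L.toLimitMixedHodgeStructure.sharp hsplit).weilOperator w) (conj w) -
          ((l ! : ℕ) : ℂ)⁻¹ * (Complex.I ^ a * (Complex.I ^ b)⁻¹ * L.Q.baseChange ℂ w ((L.N.baseChange ℂ ^ l) (conj w))))) * hI

/-! ## §5 Distinct primitive pieces of the same weight are orthogonal for the Hodge form of `F_♯` -/

/-- **`Q(C_♯ v, w̄) = 0` for `v ∈ P^{a,b}`, `w ∈ P^{a',b'}` with `a + b = a' + b' = k + l` and `a ≠ a'`**: the bigrading of the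
primitive part `P_{k+l} = ⊕_{a+b=k+l} P^{a,b}` is ORTHOGONAL for the Hodge form of `F_♯` — in the Hodge decompositions
`v = Σ_t c(u_t)`, `w = Σ_{t'} c(u'_{t'})` (`c(u_t) ∈ H_♯^{a-t}`, `c(u'_{t'}) ∈ H_♯^{a'-t'}`) the terms in different Hodge pieces are
orthogonal, and those in the same piece (`a - t = a' - t'`, so `t ≠ t'`) are cross terms of different string positions, which
vanish (`Q(N^t P^{p+t,·}, w_♯ conj(N^{t'} P^{p+t',·})) = 0`, Balnojan–Hertling (3.10)). [cite: BalnojanHertling2018, Lemma 3.5 (3.10)]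
[cite: CattaniElZeinGriffithsLe2014, §7.5 Thm. 7.5.13 (1) with Def. 7.5.9 (4)] -/
theorem form_weilOperator_sharp_conj_eq_zero_of_mem_deligneI_inf_ker_of_ne (hsplit : L.toMixedHodgeStructure.IsSplitOverR)
    {l : ℕ} {a b a' b' : ℤ} (hab : a + b = k + l) (hab' : a' + b' = k + l) (hne : a ≠ a') {v w : ℂ ⊗[ℚ] V}
    (hv : v ∈ L.toMixedHodgeStructure.deligneI a b ⊓ LinearMap.ker (L.N.baseChange ℂ ^ (l + 1)))
    (hw : w ∈ L.toMixedHodgeStructure.deligneI a' b' ⊓ LinearMap.ker (L.N.baseChange ℂ ^ (l + 1))) :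
    L.Q.baseChange ℂ ((L.toLimitMixedHodgeStructure.sharp hsplit).weilOperator v) (conj w) = 0 := by
  have hpv : v ∈ primitiveSpace (-L.deligneH) (L.N.baseChange ℂ) l := L.deligneI_inf_ker_pow_le_primitiveSpace l hab hv
  have hpw : w ∈ primitiveSpace (-L.deligneH) (L.N.baseChange ℂ) l := L.deligneI_inf_ker_pow_le_primitiveSpace l hab' hw
  have hf : ∀ t : ℕ, L.cayley (((2 : ℂ)⁻¹ ^ l * ((-(2 * Complex.I)) ^ t * ((t ! : ℕ) : ℂ)⁻¹)) • (L.N.baseChange ℂ ^ t) v) ∈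
      (L.toLimitMixedHodgeStructure.sharp hsplit).piece (a - t) (k - (a - t)) := fun t =>
    L.cayley_smul_pow_N_apply_mem_sharp_piece hsplit t _ hv.1
  have hf' : ∀ t : ℕ, L.cayley (((2 : ℂ)⁻¹ ^ l * ((-(2 * Complex.I)) ^ t * ((t ! : ℕ) : ℂ)⁻¹)) • (L.N.baseChange ℂ ^ t) w) ∈
      (L.toLimitMixedHodgeStructure.sharp hsplit).piece (a' - t) (k - (a' - t)) := fun t =>
    L.cayley_smul_pow_N_apply_mem_sharp_piece hsplit t _ hw.1
  rw [L.eq_sum_cayley_smul_pow_N_apply_of_mem_primitiveSpace hpv, L.eq_sum_cayley_smul_pow_N_apply_of_mem_primitiveSpace hpw,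
    map_sum, map_sum, LinearMap.sum_apply]
  refine Finset.sum_eq_zero fun t ht => ?_
  rw [map_sum, map_sum]
  refine Finset.sum_eq_zero fun t' ht' => ?_
  have htl : t ≤ l := Finset.mem_range_succ_iff.1 ht
  have htl' : t' ≤ l := Finset.mem_range_succ_iff.1 ht'
  rw [weilOperator_apply_of_mem _ (hf t), LinearMap.map_smul₂, smul_eq_mul]
  by_cases hp : a - (t : ℕ) = a' - (t' : ℕ)
  · -- same Hodge piece, different string positions
    have htt' : t ≠ t' := fun h => hne (by rw [h] at hp; omega)
    have e1 : a - (t : ℕ) + ((t : ℕ) : ℤ) = a := by ring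
    have e2 : k + ((l - t : ℕ) : ℤ) - (a - (t : ℕ)) = b := by rw [Nat.cast_sub htl]; omega
    have e3 : l - t + t + 1 = l + 1 := by rw [Nat.sub_add_cancel htl]
    have e1' : a - (t : ℕ) + ((t' : ℕ) : ℤ) = a' := by rw [hp]; ring
    have e2' : k + ((l - t' : ℕ) : ℤ) - (a - (t : ℕ)) = b' := by rw [hp, Nat.cast_sub htl']; omega
    have e3' : l - t' + t' + 1 = l + 1 := by rw [Nat.sub_add_cancel htl']
    have hv' : v ∈ L.toMixedHodgeStructure.deligneI (a - (t : ℕ) + ((t : ℕ) : ℤ)) (k + ((l - t : ℕ) : ℤ) - (a - (t : ℕ))) ⊓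
        LinearMap.ker (L.N.baseChange ℂ ^ (l - t + t + 1)) := by
      rw [e1, e2, e3]
      exact hv
    have hw' : w ∈ L.toMixedHodgeStructure.deligneI (a - (t : ℕ) + ((t' : ℕ) : ℤ)) (k + ((l - t' : ℕ) : ℤ) - (a - (t : ℕ))) ⊓
        LinearMap.ker (L.N.baseChange ℂ ^ (l - t' + t' + 1)) := by
      rw [e1', e2', e3']
      exact hw
    have hne' : ((l - t : ℕ), t) ≠ ((l - t' : ℕ), t') := fun h => htt' (Prod.mk.inj h).2
    rw [L.Q_baseChange_cayley_conj_cayley hsplit, conj_smul, LinearMap.map_smul₂, map_smul, map_smul, smul_eq_mul, smul_eq_mul,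
      L.Q_baseChange_pow_sharpWeyl_conj_pow_eq_zero hsplit hne' hv' hw', mul_zero, mul_zero, mul_zero]
  · -- different Hodge pieces
    have h0 : L.Q.baseChange ℂ (L.cayley (((2 : ℂ)⁻¹ ^ l * ((-(2 * Complex.I)) ^ t * ((t ! : ℕ) : ℂ)⁻¹)) • (L.N.baseChange ℂ ^ t) v))
        (conj (L.cayley (((2 : ℂ)⁻¹ ^ l * ((-(2 * Complex.I)) ^ t' * ((t' ! : ℕ) : ℂ)⁻¹)) • (L.N.baseChange ℂ ^ t') w))) = 0 :=
      (L.sharpPolarization hsplit).form_piece_conj_piece hp (hf t) (hf' t')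
    rw [h0, mul_zero]

/-! ## §6 The reference form `⟨·,·⟩₀` of the norm estimates on the primitive bigraded pieces of the `δ`-splitting -/

/-- **THE LIMIT HODGE FORM ON `P^{a,b}`: `⟨v, w⟩₀ = Q(C_{F̂_♯} v, w̄) = (1/l!) · (i^a/i^b) · Q(v, N^l w̄)`** for `v, w ∈ Î^{a,b} ∩ ker N^{l+1}`,
`a + b = k + l` (`Î` = Deligne's bigrading of the `δ`-split limit mixed Hodge structure; `⟨·,·⟩₀` the Hodge form at `F̂_♯`, whose
norm `|·|₀` is the reference norm of «`‖v‖² = (-log|s|)^ℓ |v|₀²`»). [cite: CattaniKaplanSchmid1987, §2 (2.18) and §3 Cor. (3.7)]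
[cite: Schmid1973, Thm. (6.6) (cite only)] [cite: CattaniElZeinGriffithsLe2014, §7.5 Thm. 7.5.13 (1) with Def. 7.5.9 (4)] -/
theorem Q_weilOperator_deltaSplit_sharp_conj_of_mem_deligneI_inf_ker {l : ℕ} {a b : ℤ} (hab : a + b = k + l)
    {v w : ℂ ⊗[ℚ] V}
    (hv : v ∈ L.deltaSplit.toMixedHodgeStructure.deligneI a b ⊓ LinearMap.ker (L.N.baseChange ℂ ^ (l + 1)))
    (hw : w ∈ L.deltaSplit.toMixedHodgeStructure.deligneI a b ⊓ LinearMap.ker (L.N.baseChange ℂ ^ (l + 1))) :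
    L.Q.baseChange ℂ ((L.deltaSplit.toLimitMixedHodgeStructure.sharp L.isSplitOverR_deltaSplit).weilOperator v) (conj w) =
      ((l ! : ℕ) : ℂ)⁻¹ * (Complex.I ^ a * (Complex.I ^ b)⁻¹ * L.Q.baseChange ℂ v ((L.N.baseChange ℂ ^ l) (conj w))) :=
  L.deltaSplit.form_weilOperator_sharp_conj_of_mem_deligneI_inf_ker L.isSplitOverR_deltaSplit hab hv hw

/-- **Distinct primitive pieces of the same weight are `⟨·,·⟩₀`-orthogonal**: `⟨v, w⟩₀ = 0` for `v ∈ Î^{a,b} ∩ ker N^{l+1}`,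
`w ∈ Î^{a',b'} ∩ ker N^{l+1}`, `a + b = a' + b' = k + l`, `a ≠ a'`. [cite: BalnojanHertling2018, Lemma 3.5 (3.10)]
[cite: CattaniKaplanSchmid1987, §2 (2.18)] -/
theorem Q_weilOperator_deltaSplit_sharp_conj_eq_zero_of_ne {l : ℕ} {a b a' b' : ℤ} (hab : a + b = k + l)
    (hab' : a' + b' = k + l) (hne : a ≠ a') {v w : ℂ ⊗[ℚ] V}
    (hv : v ∈ L.deltaSplit.toMixedHodgeStructure.deligneI a b ⊓ LinearMap.ker (L.N.baseChange ℂ ^ (l + 1)))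
    (hw : w ∈ L.deltaSplit.toMixedHodgeStructure.deligneI a' b' ⊓ LinearMap.ker (L.N.baseChange ℂ ^ (l + 1))) :
    L.Q.baseChange ℂ ((L.deltaSplit.toLimitMixedHodgeStructure.sharp L.isSplitOverR_deltaSplit).weilOperator v) (conj w) = 0 :=
  L.deltaSplit.form_weilOperator_sharp_conj_eq_zero_of_mem_deligneI_inf_ker_of_ne L.isSplitOverR_deltaSplit hab hab' hne hv hw

end PolarizedLimitMixedHodgeStructure

end Literature.AlgebraicGeometry.HodgeTheory

end
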